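import Summits.HubbardSuperconductivity.HubbardSuperconductivity.Theorems.AnisotropyChordTransferFibre3RowDSlots

/-!
# Route `AnisotropyChord` / H0 rotor rung, row D (KT-2a) Stage-1 evaluator: the CLOSED `δ`-TERMS `closedPartU/V²` as `RExpr` (pairs)

Layer C of the row-D program (p1 g29 memo ROWD-DESIGN-g29 §6).  g27's `closedPartU L lam2 ψ₃ ψ₁ ψ₂ k₂ k₃` (the 7 `δ`-collapsed terms of a
three-slot spec convolution, `…RowDConvExpansionU`) divided by `V²`, at torus images of INTEGER points and for the TYPED slots of the row-D
inventory (`kind = JU | S`, unweighted `(u,u′) = (1,0)` or `D_e`-weighted `(1,−1)`; semantic spec ★ `psiU`), is evaluated EXACTLY: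
* ★ `closedPartU_unweighted` — generic 7-term form in `α_i`, `d(q) = [q̄ = 0]`, `ρ_i(q) = R_ψᵢ(q)/V` when all three slots are unweighted;
  ★ `closedPartU_w12`, `closedPartU_w31`, `closedPartU_w32` — with TWO weighted slots only ONE term survives (`W = u + u′ = 0` kills the rest):
  `α_u · ρ_a · ρ_b`;
* the atoms: ★ `eval_alE` (`α_JU = a`, `α_S = 1 − a + a/V`), ★ `eval_rE0` (`ρ` unweighted), ★ `eval_rEw` (`ρ` weighted `= seval(swt (q·e))·ρ⁰`),
  ★ `eval_dI` (`d` at integer points, `L ≥ 7`);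
* ★ `closedM_eval` — `closedM` (a REAL `RExpr`) evaluates to `closedPartU/V²` for three unweighted slots (the spectator-form / `M` monomials);
  ★ `closedN3_eval`, ★ `closedN1_eval`, ★ `closedN2_eval` — `closedN*` (ORDINARY pairs) satisfy `t · peval = closedPartU/V²` for the three weight
  patterns of the `C0`-form / `N` monomials (the factor `t` of the two gradient weights dropped symbolically by `smulS`).
Prover seat `hubbard-h0-rotor-p1` g29 (route lead); helper for piece A = stmt-HubbardSuperconductivity-23918 of rung 19089
(`--supports`, helper class).  Nothing here proves superconductivity in the Hubbard model; lemmas for ONE row of ONE conditional reduction;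
the rotor TARGET as originally worded stays FALSE (g15 verdict).  Tree imports only; no sorry.
-/

set_option linter.dupNamespace false
set_option autoImplicit false

open Literature.Analysis.ValidatedNumerics

namespace Summit.HubbardSuperconductivity.HubbardSuperconductivity.Theorems.AnisotropyChord.Transfer.Fibre3

namespace RowD

open RowC L2.N1

variable (L : ℕ) [NeZero L]

/-! ## Generic shapes of `closedPartU` -/

section generic
variable (lam2 : ℝ)

/-- ★ all three slots unweighted: the 7-term form in `α_i`, `d`, `ρ_i = R_i/V`. -/
theorem closedPartU_unweighted (α₃ β₃ γ₃ α₁ β₁ γ₁ α₂ β₂ γ₂ : ℝ) (e₃ e₁ e₂ k₂ k₃ : Tor L) :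
    closedPartU L lam2 (e₃, 1, 0, α₃, β₃, γ₃) (e₁, 1, 0, α₁, β₁, γ₁) (e₂, 1, 0, α₂, β₂, γ₂) k₂ k₃
      = ((L : ℂ) ^ 2) ^ 2 *
        ( (α₃ : ℂ) * α₁ * α₂ * (if k₂ = 0 then 1 else 0) * (if k₃ = 0 then 1 else 0)
        + (α₃ : ℂ) * α₁ * (if k₂ = 0 then 1 else 0) * (RfacU L lam2 (e₂, 1, 0, α₂, β₂, γ₂) k₃ / (L : ℂ) ^ 2)
        + (α₃ : ℂ) * α₂ * (if k₃ = 0 then 1 else 0) * (RfacU L lam2 (e₁, 1, 0, α₁, β₁, γ₁) k₂ / (L : ℂ) ^ 2)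
        + (α₁ : ℂ) * α₂ * (if k₂ + k₃ = 0 then 1 else 0) * (RfacU L lam2 (e₃, 1, 0, α₃, β₃, γ₃) (-k₂) / (L : ℂ) ^ 2)
        + (α₃ : ℂ) * (RfacU L lam2 (e₁, 1, 0, α₁, β₁, γ₁) k₂ / (L : ℂ) ^ 2) * (RfacU L lam2 (e₂, 1, 0, α₂, β₂, γ₂) k₃ / (L : ℂ) ^ 2)
        + (α₁ : ℂ) * (RfacU L lam2 (e₃, 1, 0, α₃, β₃, γ₃) (-k₂) / (L : ℂ) ^ 2)
            * (RfacU L lam2 (e₂, 1, 0, α₂, β₂, γ₂) (k₂ + k₃) / (L : ℂ) ^ 2)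
        + (α₂ : ℂ) * (RfacU L lam2 (e₃, 1, 0, α₃, β₃, γ₃) k₃ / (L : ℂ) ^ 2)
            * (RfacU L lam2 (e₁, 1, 0, α₁, β₁, γ₁) (k₂ + k₃) / (L : ℂ) ^ 2) ) := by
  have hL0 : (L : ℂ) ≠ 0 := by exact_mod_cast NeZero.ne L
  unfold closedPartU
  simp only
  push_cast
  field_simp
  ring

/-- ★ slots 1, 2 weighted, slot 3 unweighted: only `α₃ ρ₁(k₂) ρ₂(k₃)` survives. -/
theorem closedPartU_w12 (α₃ β₃ γ₃ α₁ β₁ γ₁ α₂ β₂ γ₂ : ℝ) (e₃ e₁ e₂ k₂ k₃ : Tor L) :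
    closedPartU L lam2 (e₃, 1, 0, α₃, β₃, γ₃) (e₁, 1, -1, α₁, β₁, γ₁) (e₂, 1, -1, α₂, β₂, γ₂) k₂ k₃
      = ((L : ℂ) ^ 2) ^ 2 * ((α₃ : ℂ) * (RfacU L lam2 (e₁, 1, -1, α₁, β₁, γ₁) k₂ / (L : ℂ) ^ 2)
          * (RfacU L lam2 (e₂, 1, -1, α₂, β₂, γ₂) k₃ / (L : ℂ) ^ 2)) := by
  have hL0 : (L : ℂ) ≠ 0 := by exact_mod_cast NeZero.ne L
  unfold closedPartU
  simp only
  push_cast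
  field_simp
  ring

/-- ★ slots 3, 1 weighted, slot 2 unweighted: only `α₂ ρ₃(k₃) ρ₁(k₂+k₃)` survives. -/
theorem closedPartU_w31 (α₃ β₃ γ₃ α₁ β₁ γ₁ α₂ β₂ γ₂ : ℝ) (e₃ e₁ e₂ k₂ k₃ : Tor L) :
    closedPartU L lam2 (e₃, 1, -1, α₃, β₃, γ₃) (e₁, 1, -1, α₁, β₁, γ₁) (e₂, 1, 0, α₂, β₂, γ₂) k₂ k₃
      = ((L : ℂ) ^ 2) ^ 2 * ((α₂ : ℂ) * (RfacU L lam2 (e₃, 1, -1, α₃, β₃, γ₃) k₃ / (L : ℂ) ^ 2)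
          * (RfacU L lam2 (e₁, 1, -1, α₁, β₁, γ₁) (k₂ + k₃) / (L : ℂ) ^ 2)) := by
  have hL0 : (L : ℂ) ≠ 0 := by exact_mod_cast NeZero.ne L
  unfold closedPartU
  simp only
  push_cast
  field_simp
  ring

/-- ★ slots 3, 2 weighted, slot 1 unweighted: only `α₁ ρ₃(−k₂) ρ₂(k₂+k₃)` survives. -/
theorem closedPartU_w32 (α₃ β₃ γ₃ α₁ β₁ γ₁ α₂ β₂ γ₂ : ℝ) (e₃ e₁ e₂ k₂ k₃ : Tor L) :
    closedPartU L lam2 (e₃, 1, -1, α₃, β₃, γ₃) (e₁, 1, 0, α₁, β₁, γ₁) (e₂, 1, -1, α₂, β₂, γ₂) k₂ k₃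
      = ((L : ℂ) ^ 2) ^ 2 * ((α₁ : ℂ) * (RfacU L lam2 (e₃, 1, -1, α₃, β₃, γ₃) (-k₂) / (L : ℂ) ^ 2)
          * (RfacU L lam2 (e₂, 1, -1, α₂, β₂, γ₂) (k₂ + k₃) / (L : ℂ) ^ 2)) := by
  have hL0 : (L : ℂ) ≠ 0 := by exact_mod_cast NeZero.ne L
  unfold closedPartU
  simp only
  push_cast
  field_simp
  ring

end generic

/-! ## Typed slots and their atoms -/

/-- ★ the semantic uniform spec of a typed slot of the row-D inventory: `kind = false`: `JU` (`α = a`, `β = −a`, `γ = 0`);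
`kind = true`: `S` (`α = 1 − a + a/V`, `β = 0`, `γ = −c_s`); weight data `(u, u′)` and weight vector `e`. -/
noncomputable def psiU (Δ lam2 : ℝ) (f : Tor L → ℝ) (kind : Bool) (u u' : ℝ) (e : Tor L) : Tor L × ℝ × ℝ × ℝ × ℝ × ℝ :=
  if kind then (e, u, u', 1 - Δ * f (K1 L) + Δ * f (K1 L) / (L : ℝ) ^ 2, 0, -cS L Δ lam2 f)
  else (e, u, u', Δ * f (K1 L), -(Δ * f (K1 L)), 0)

/-- the `δ`-coefficient atom `α_kind`. -/
def alE (kind : Bool) : RExpr := if kind then uu else vA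

/-- the `V`-normalised unweighted regular factor `ρ⁰_kind(q)`. -/
def rE (kind : Bool) (q : ℤ × ℤ) : RExpr := if kind then rSE q else rJE

/-- the integer Kronecker delta `d(q) = [q = 0]`. -/
def dI (q : ℤ × ℤ) : RExpr := if q = (0, 0) then cst 1 else cst 0

omit [NeZero L] in
/-- grid points lie in the box `[−3, 3]²`. -/
theorem grid_mem_box3 : ∀ q ∈ gridPts 3, q ∈ B1.box 3 := by
  unfold B1.box; decide

/-- `q̄ = 0 ↔ q = 0` for `q = 0` or a grid point, `L ≥ 7`. -/
theorem toTor_eq_zero_iff (hL : 7 ≤ L) {q : ℤ × ℤ} (hq : q = (0, 0) ∨ q ∈ gridPts 3) :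
    B1.toTor L q = 0 ↔ q = (0, 0) := by
  have h0 : B1.toTor L ((0, 0) : ℤ × ℤ) = 0 := B1.toTor_zero L
  constructor
  · intro h
    rcases hq with hq | hq
    · exact hq
    · have hb := grid_mem_box3 q hq
      have hz : ((0, 0) : ℤ × ℤ) ∈ B1.box 3 := by unfold B1.box; decide
      have h6 : 2 * 3 < L := by omega
      rw [← B1.rep_toTor_of_mem_box L 3 h6 q hb, h, ← h0, B1.rep_toTor_of_mem_box L 3 h6 _ hz]
  · rintro rfl; exact h0

section atoms
variable (Δ lam2 : ℝ) (f : Tor L → ℝ)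

/-- ★ `dI q ↦ d(q̄)`. -/
theorem eval_dI (hL : 7 ≤ L) {q : ℤ × ℤ} (hq : q = (0, 0) ∨ q ∈ gridPts 3) (x : ℕ → ℝ) :
    (((dI q).eval x : ℝ) : ℂ) = if B1.toTor L q = 0 then 1 else 0 := by
  unfold dI
  by_cases h : q = (0, 0)
  · rw [if_pos h, if_pos ((toTor_eq_zero_iff L hL hq).mpr h)]; simp [cst, RExpr.eval]
  · rw [if_neg h, if_neg (fun h' => h ((toTor_eq_zero_iff L hL hq).mp h'))]; simp [cst, RExpr.eval]

/-- ★ `alE kind ↦ α_kind` (the `δ`-coefficient of `psiU kind`). -/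
theorem eval_alE (hL : 5 ≤ L) (hΔ0 : 0 ≤ Δ) (hΔ1 : Δ < 1) (hf : IsGroundTwoMagnon L Δ lam2 f) (hlam : 0 < lam2)
    (kind : Bool) (u u' : ℝ) (e : Tor L) :
    (alE kind).eval (xTrueD L Δ lam2 f) = (psiU L Δ lam2 f kind u u' e).2.2.2.1 := by
  obtain ⟨-, -, duu⟩ := dictD L Δ lam2 f hL hΔ0 hΔ1 hf hlam
  cases kind
  · simp only [alE, psiU, RExpr.eval, vA, if_false, Bool.false_eq_true]; exact xTrueD_three L Δ lam2 f
  · simp only [alE, psiU, if_true]; exact duu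

/-- ★ `rE kind q ↦ ρ⁰_kind(q̄) = R_(psiU kind 1 0 e)(q̄)/V` (`q = 0` or a grid point). -/
theorem eval_rE0 (hL : 5 ≤ L) (hΔ0 : 0 ≤ Δ) (hΔ1 : Δ < 1) (hf : IsGroundTwoMagnon L Δ lam2 f) (hlam : 0 < lam2)
    (kind : Bool) (e : Tor L) {q : ℤ × ℤ} (hq : q = (0, 0) ∨ q ∈ gridPts 3) :
    (((rE kind q).eval (xTrueD L Δ lam2 f) : ℝ) : ℂ) = RfacU L lam2 (psiU L Δ lam2 f kind 1 0 e) (B1.toTor L q) / (L : ℂ) ^ 2 := by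
  cases kind
  · simp only [rE, psiU, if_false, Bool.false_eq_true]
    exact eval_rJE L Δ lam2 f hL hΔ0 hΔ1 hf hlam _ e _
  · simp only [rE, psiU, if_true]
    exact eval_rSE L Δ lam2 f hL hΔ0 hΔ1 hf hlam _ e hq

/-- ★ weighted: `seval(swt (q·e)) · rE kind q ↦ R_(psiU kind 1 (−1) ē)(q̄)/V` (`q = 0` or a grid point, `|q·e| ≤ 3`, `L ≥ 5`). -/
theorem eval_rEw (hL : 5 ≤ L) (hΔ0 : 0 ≤ Δ) (hΔ1 : Δ < 1) (hf : IsGroundTwoMagnon L Δ lam2 f) (hlam : 0 < lam2)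
    (kind : Bool) (e : ℤ × ℤ) {q : ℤ × ℤ} (hq : q = (0, 0) ∨ q ∈ gridPts 3) (hm : (qdot q e).natAbs ≤ 3) :
    seval (2 * Real.pi / L) (xTrueD L Δ lam2 f) (swt (qdot q e)) * (((rE kind q).eval (xTrueD L Δ lam2 f) : ℝ) : ℂ)
      = RfacU L lam2 (psiU L Δ lam2 f kind 1 (-1) (B1.toTor L e)) (B1.toTor L q) / (L : ℂ) ^ 2 := by
  rw [eval_rE0 L Δ lam2 f hL hΔ0 hΔ1 hf hlam kind (B1.toTor L e) hq]
  cases kind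
  · simp only [psiU, if_false, Bool.false_eq_true]
    rw [rfacU_weighted_toTor L Δ lam2 f (by omega) _ _ _ q e hm, rfacU_unweighted]; ring
  · simp only [psiU, if_true]
    rw [rfacU_weighted_toTor L Δ lam2 f (by omega) _ _ _ q e hm, rfacU_unweighted]; ring

end atoms

/-! ## The closed evaluators -/

/-- `closedPartU/V²` for three UNWEIGHTED typed slots (kinds `k3 k1 k2`) at integer momenta `k₂, k₃`: a real `RExpr`. -/
def closedM (k3 k1 k2 : Bool) (k₂ k₃ : ℤ × ℤ) : RExpr :=
  .add (.add (.add (.add (.add (.add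
    (.mul (.mul (.mul (.mul (alE k3) (alE k1)) (alE k2)) (dI k₂)) (dI k₃))
    (.mul (.mul (.mul (alE k3) (alE k1)) (dI k₂)) (rE k2 k₃)))
    (.mul (.mul (.mul (alE k3) (alE k2)) (dI k₃)) (rE k1 k₂)))
    (.mul (.mul (.mul (alE k1) (alE k2)) (dI (k₂ + k₃))) (rE k3 (-k₂))))
    (.mul (.mul (alE k3) (rE k1 k₂)) (rE k2 k₃)))
    (.mul (.mul (alE k1) (rE k3 (-k₂))) (rE k2 (k₂ + k₃))))
    (.mul (.mul (alE k2) (rE k3 k₃)) (rE k1 (k₂ + k₃)))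

/-- `closedPartU/(V²t)` for slots 1, 2 weighted (vectors `e₁, e₂`), slot 3 unweighted: the ordinary pair `α₃ ρ⁰₁(k₂) ρ⁰₂(k₃) · smulS(swt, swt)`. -/
def closedN3 (k3 k1 k2 : Bool) (e₁ e₂ k₂ k₃ : ℤ × ℤ) : RExpr × RExpr :=
  pscale (.mul (.mul (alE k3) (rE k1 k₂)) (rE k2 k₃)) (smulS (swt (qdot k₂ e₁)) (swt (qdot k₃ e₂)))

/-- `closedPartU/(V²t)` for slots 3, 1 weighted (vectors `e₃, e₁`), slot 2 unweighted: `α₂ ρ⁰₃(k₃) ρ⁰₁(k₂+k₃) · smulS(swt, swt)`. -/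
def closedN2 (k3 k1 k2 : Bool) (e₃ e₁ k₂ k₃ : ℤ × ℤ) : RExpr × RExpr :=
  pscale (.mul (.mul (alE k2) (rE k3 k₃)) (rE k1 (k₂ + k₃))) (smulS (swt (qdot k₃ e₃)) (swt (qdot (k₂ + k₃) e₁)))

/-- `closedPartU/(V²t)` for slots 3, 2 weighted (vectors `e₃, e₂`), slot 1 unweighted: `α₁ ρ⁰₃(−k₂) ρ⁰₂(k₂+k₃) · smulS(swt, swt)`. -/
def closedN1 (k3 k1 k2 : Bool) (e₃ e₂ k₂ k₃ : ℤ × ℤ) : RExpr × RExpr :=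
  pscale (.mul (.mul (alE k1) (rE k3 (-k₂))) (rE k2 (k₂ + k₃))) (smulS (swt (qdot (-k₂) e₃)) (swt (qdot (k₂ + k₃) e₂)))

section evals
variable (Δ lam2 : ℝ) (f : Tor L → ℝ)

/-- ★ `closedM ↦ closedPartU/V²` (three unweighted typed slots; `k₂, k₃, k₂+k₃, −k₂` each `0` or a grid point; ground profile, `L ≥ 7`). -/
theorem closedM_eval (hL : 7 ≤ L) (hΔ0 : 0 ≤ Δ) (hΔ1 : Δ < 1) (hf : IsGroundTwoMagnon L Δ lam2 f) (hlam : 0 < lam2)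
    (k3 k1 k2 : Bool) (e₃ e₁ e₂ : Tor L) {k₂ k₃ : ℤ × ℤ}
    (h2 : k₂ = (0, 0) ∨ k₂ ∈ gridPts 3) (h3 : k₃ = (0, 0) ∨ k₃ ∈ gridPts 3)
    (h23 : k₂ + k₃ = (0, 0) ∨ k₂ + k₃ ∈ gridPts 3) (hn2 : -k₂ = (0, 0) ∨ -k₂ ∈ gridPts 3) :
    (((closedM k3 k1 k2 k₂ k₃).eval (xTrueD L Δ lam2 f) : ℝ) : ℂ)
      = closedPartU L lam2 (psiU L Δ lam2 f k3 1 0 e₃) (psiU L Δ lam2 f k1 1 0 e₁) (psiU L Δ lam2 f k2 1 0 e₂)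
          (B1.toTor L k₂) (B1.toTor L k₃) / ((L : ℂ) ^ 2) ^ 2 := by
  have hL5 : 5 ≤ L := by omega
  have hV : ((L : ℂ) ^ 2) ^ 2 ≠ 0 := by
    have : (L : ℂ) ≠ 0 := by exact_mod_cast NeZero.ne L
    positivity
  -- atoms
  have a3 := eval_alE L Δ lam2 f hL5 hΔ0 hΔ1 hf hlam k3 1 0 e₃
  have a1 := eval_alE L Δ lam2 f hL5 hΔ0 hΔ1 hf hlam k1 1 0 e₁
  have a2 := eval_alE L Δ lam2 f hL5 hΔ0 hΔ1 hf hlam k2 1 0 e₂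
  have r2k3 := eval_rE0 L Δ lam2 f hL5 hΔ0 hΔ1 hf hlam k2 e₂ h3
  have r1k2 := eval_rE0 L Δ lam2 f hL5 hΔ0 hΔ1 hf hlam k1 e₁ h2
  have r3n2 := eval_rE0 L Δ lam2 f hL5 hΔ0 hΔ1 hf hlam k3 e₃ hn2
  have r2s := eval_rE0 L Δ lam2 f hL5 hΔ0 hΔ1 hf hlam k2 e₂ h23
  have r3k3 := eval_rE0 L Δ lam2 f hL5 hΔ0 hΔ1 hf hlam k3 e₃ h3
  have r1s := eval_rE0 L Δ lam2 f hL5 hΔ0 hΔ1 hf hlam k1 e₁ h23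
  have d2 := eval_dI L hL h2 (xTrueD L Δ lam2 f)
  have d3 := eval_dI L hL h3 (xTrueD L Δ lam2 f)
  have d23 := eval_dI L hL h23 (xTrueD L Δ lam2 f)
  -- the generic shape, for the three typed specs
  have shape : ∀ kd : Bool, ∀ u u' : ℝ, ∀ e : Tor L,
      psiU L Δ lam2 f kd u u' e = (e, u, u', (psiU L Δ lam2 f kd u u' e).2.2.2.1,
        (psiU L Δ lam2 f kd u u' e).2.2.2.2.1, (psiU L Δ lam2 f kd u u' e).2.2.2.2.2) := by
    intro kd u u' e; cases kd <;> simp [psiU]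
  rw [shape k3 1 0 e₃, shape k1 1 0 e₁, shape k2 1 0 e₂, closedPartU_unweighted, mul_div_cancel_left₀ _ hV]
  rw [← shape k3 1 0 e₃, ← shape k1 1 0 e₁, ← shape k2 1 0 e₂]
  rw [B1.toTor_add] at r2s r1s d23
  rw [B1.toTor_neg] at r3n2
  rw [← r2k3, ← r1k2, ← r3n2, ← r2s, ← r3k3, ← r1s, ← d2, ← d3, ← d23, ← a3, ← a1, ← a2]
  simp only [closedM, RExpr.eval]
  push_cast
  ring

/-- ★ `t · peval closedN3 = closedPartU/V²` (slots 1, 2 weighted along integer vectors `e₁, e₂`; `|k₂·e₁|, |k₃·e₂| ≤ 3`). -/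
theorem closedN3_eval (hL : 7 ≤ L) (hΔ0 : 0 ≤ Δ) (hΔ1 : Δ < 1) (hf : IsGroundTwoMagnon L Δ lam2 f) (hlam : 0 < lam2)
    (k3 k1 k2 : Bool) (e₃ : Tor L) (e₁ e₂ : ℤ × ℤ) {k₂ k₃ : ℤ × ℤ}
    (h2 : k₂ = (0, 0) ∨ k₂ ∈ gridPts 3) (h3 : k₃ = (0, 0) ∨ k₃ ∈ gridPts 3)
    (hm1 : (qdot k₂ e₁).natAbs ≤ 3) (hm2 : (qdot k₃ e₂).natAbs ≤ 3) :
    (((2 * Real.pi / L) ^ 2 : ℝ) : ℂ) * peval (2 * Real.pi / L) (xTrueD L Δ lam2 f) (closedN3 k3 k1 k2 e₁ e₂ k₂ k₃)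
      = closedPartU L lam2 (psiU L Δ lam2 f k3 1 0 e₃) (psiU L Δ lam2 f k1 1 (-1) (B1.toTor L e₁))
          (psiU L Δ lam2 f k2 1 (-1) (B1.toTor L e₂)) (B1.toTor L k₂) (B1.toTor L k₃) / ((L : ℂ) ^ 2) ^ 2 := by
  have hL5 : 5 ≤ L := by omega
  have hV : ((L : ℂ) ^ 2) ^ 2 ≠ 0 := by
    have : (L : ℂ) ≠ 0 := by exact_mod_cast NeZero.ne L
    positivity
  have a3 := eval_alE L Δ lam2 f hL5 hΔ0 hΔ1 hf hlam k3 1 0 e₃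
  have w1 := eval_rEw L Δ lam2 f hL5 hΔ0 hΔ1 hf hlam k1 e₁ h2 hm1
  have w2 := eval_rEw L Δ lam2 f hL5 hΔ0 hΔ1 hf hlam k2 e₂ h3 hm2
  have shape : ∀ kd : Bool, ∀ u u' : ℝ, ∀ e : Tor L,
      psiU L Δ lam2 f kd u u' e = (e, u, u', (psiU L Δ lam2 f kd u u' e).2.2.2.1,
        (psiU L Δ lam2 f kd u u' e).2.2.2.2.1, (psiU L Δ lam2 f kd u u' e).2.2.2.2.2) := by
    intro kd u u' e; cases kd <;> simp [psiU]
  rw [shape k3 1 0 e₃, shape k1 1 (-1) (B1.toTor L e₁), shape k2 1 (-1) (B1.toTor L e₂), closedPartU_w12,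
    mul_div_cancel_left₀ _ hV]
  rw [← shape k1 1 (-1) (B1.toTor L e₁), ← shape k2 1 (-1) (B1.toTor L e₂), ← w1, ← w2, ← a3]
  unfold closedN3
  rw [peval_pscale, mul_left_comm, peval_smulS (2 * Real.pi / L) (xTrueD L Δ lam2 f) (xTrueD_zero L Δ lam2 f)]
  simp only [RExpr.eval]
  push_cast
  ring

/-- ★ `t · peval closedN2 = closedPartU/V²` (slots 3, 1 weighted along `e₃, e₁`; `|k₃·e₃|, |(k₂+k₃)·e₁| ≤ 3`). -/
theorem closedN2_eval (hL : 7 ≤ L) (hΔ0 : 0 ≤ Δ) (hΔ1 : Δ < 1) (hf : IsGroundTwoMagnon L Δ lam2 f) (hlam : 0 < lam2)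
    (k3 k1 k2 : Bool) (e₂ : Tor L) (e₃ e₁ : ℤ × ℤ) {k₂ k₃ : ℤ × ℤ}
    (h3 : k₃ = (0, 0) ∨ k₃ ∈ gridPts 3) (h23 : k₂ + k₃ = (0, 0) ∨ k₂ + k₃ ∈ gridPts 3)
    (hm3 : (qdot k₃ e₃).natAbs ≤ 3) (hm1 : (qdot (k₂ + k₃) e₁).natAbs ≤ 3) :
    (((2 * Real.pi / L) ^ 2 : ℝ) : ℂ) * peval (2 * Real.pi / L) (xTrueD L Δ lam2 f) (closedN2 k3 k1 k2 e₃ e₁ k₂ k₃)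
      = closedPartU L lam2 (psiU L Δ lam2 f k3 1 (-1) (B1.toTor L e₃)) (psiU L Δ lam2 f k1 1 (-1) (B1.toTor L e₁))
          (psiU L Δ lam2 f k2 1 0 e₂) (B1.toTor L k₂) (B1.toTor L k₃) / ((L : ℂ) ^ 2) ^ 2 := by
  have hL5 : 5 ≤ L := by omega
  have hV : ((L : ℂ) ^ 2) ^ 2 ≠ 0 := by
    have : (L : ℂ) ≠ 0 := by exact_mod_cast NeZero.ne L
    positivity
  have a2 := eval_alE L Δ lam2 f hL5 hΔ0 hΔ1 hf hlam k2 1 0 e₂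
  have w3 := eval_rEw L Δ lam2 f hL5 hΔ0 hΔ1 hf hlam k3 e₃ h3 hm3
  have w1 := eval_rEw L Δ lam2 f hL5 hΔ0 hΔ1 hf hlam k1 e₁ h23 hm1
  have shape : ∀ kd : Bool, ∀ u u' : ℝ, ∀ e : Tor L,
      psiU L Δ lam2 f kd u u' e = (e, u, u', (psiU L Δ lam2 f kd u u' e).2.2.2.1,
        (psiU L Δ lam2 f kd u u' e).2.2.2.2.1, (psiU L Δ lam2 f kd u u' e).2.2.2.2.2) := by
    intro kd u u' e; cases kd <;> simp [psiU]
  rw [shape k3 1 (-1) (B1.toTor L e₃), shape k1 1 (-1) (B1.toTor L e₁), shape k2 1 0 e₂, closedPartU_w31,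
    mul_div_cancel_left₀ _ hV]
  rw [← shape k3 1 (-1) (B1.toTor L e₃), ← shape k1 1 (-1) (B1.toTor L e₁)]
  rw [B1.toTor_add] at w1
  rw [← w3, ← w1, ← a2]
  unfold closedN2
  rw [peval_pscale, mul_left_comm, peval_smulS (2 * Real.pi / L) (xTrueD L Δ lam2 f) (xTrueD_zero L Δ lam2 f)]
  simp only [RExpr.eval]
  push_cast
  ring

/-- ★ `t · peval closedN1 = closedPartU/V²` (slots 3, 2 weighted along `e₃, e₂`; `|(−k₂)·e₃|, |(k₂+k₃)·e₂| ≤ 3`). -/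
theorem closedN1_eval (hL : 7 ≤ L) (hΔ0 : 0 ≤ Δ) (hΔ1 : Δ < 1) (hf : IsGroundTwoMagnon L Δ lam2 f) (hlam : 0 < lam2)
    (k3 k1 k2 : Bool) (e₁ : Tor L) (e₃ e₂ : ℤ × ℤ) {k₂ k₃ : ℤ × ℤ}
    (hn2 : -k₂ = (0, 0) ∨ -k₂ ∈ gridPts 3) (h23 : k₂ + k₃ = (0, 0) ∨ k₂ + k₃ ∈ gridPts 3)
    (hm3 : (qdot (-k₂) e₃).natAbs ≤ 3) (hm2 : (qdot (k₂ + k₃) e₂).natAbs ≤ 3) :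
    (((2 * Real.pi / L) ^ 2 : ℝ) : ℂ) * peval (2 * Real.pi / L) (xTrueD L Δ lam2 f) (closedN1 k3 k1 k2 e₃ e₂ k₂ k₃)
      = closedPartU L lam2 (psiU L Δ lam2 f k3 1 (-1) (B1.toTor L e₃)) (psiU L Δ lam2 f k1 1 0 e₁)
          (psiU L Δ lam2 f k2 1 (-1) (B1.toTor L e₂)) (B1.toTor L k₂) (B1.toTor L k₃) / ((L : ℂ) ^ 2) ^ 2 := by
  have hL5 : 5 ≤ L := by omega
  have hV : ((L : ℂ) ^ 2) ^ 2 ≠ 0 := by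
    have : (L : ℂ) ≠ 0 := by exact_mod_cast NeZero.ne L
    positivity
  have a1 := eval_alE L Δ lam2 f hL5 hΔ0 hΔ1 hf hlam k1 1 0 e₁
  have w3 := eval_rEw L Δ lam2 f hL5 hΔ0 hΔ1 hf hlam k3 e₃ hn2 hm3
  have w2 := eval_rEw L Δ lam2 f hL5 hΔ0 hΔ1 hf hlam k2 e₂ h23 hm2
  have shape : ∀ kd : Bool, ∀ u u' : ℝ, ∀ e : Tor L,
      psiU L Δ lam2 f kd u u' e = (e, u, u', (psiU L Δ lam2 f kd u u' e).2.2.2.1,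
        (psiU L Δ lam2 f kd u u' e).2.2.2.2.1, (psiU L Δ lam2 f kd u u' e).2.2.2.2.2) := by
    intro kd u u' e; cases kd <;> simp [psiU]
  rw [shape k3 1 (-1) (B1.toTor L e₃), shape k1 1 0 e₁, shape k2 1 (-1) (B1.toTor L e₂), closedPartU_w32,
    mul_div_cancel_left₀ _ hV]
  rw [← shape k3 1 (-1) (B1.toTor L e₃), ← shape k2 1 (-1) (B1.toTor L e₂)]
  rw [B1.toTor_add] at w2
  rw [B1.toTor_neg] at w3
  rw [← w3, ← w2, ← a1]
  unfold closedN1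
  rw [peval_pscale, mul_left_comm, peval_smulS (2 * Real.pi / L) (xTrueD L Δ lam2 f) (xTrueD_zero L Δ lam2 f)]
  simp only [RExpr.eval]
  push_cast
  ring

end evals

end RowD

end Summit.HubbardSuperconductivity.HubbardSuperconductivity.Theorems.AnisotropyChord.Transfer.Fibre3
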